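import Summits.Ventures.CertifiedManyBodySolver.Observables.TISourcedClusterTrialRowsTwoIntervalsTTPrime
import Summits.Ventures.CertifiedManyBodySolver.Observables.ClusterCapTPrimeTransport
import Summits.Ventures.CertifiedManyBodySolver.Certificates.HubbardSquare_msym_lower_derived_ntangent504_row517
import Summits.Ventures.CertifiedManyBodySolver.Certificates.HubbardSquare_n7o8_sourced_openbox32x4_k3o7_mu7o4_D1000_j264564_twoFieldDiagHop
import Summits.Ventures.CertifiedManyBodySolver.Certificates.HubbardSquare_n7o8_sourced_twin32x4_k4o7_mu9o4_D1000_j271580_twoFieldDiagHop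
import HarnessLib
import Summits.Ventures.CertifiedManyBodySolver.Observables.CanonicalFloorA0SlabW32TwoW5MixedContinuum

/-!
(dedup: the branch continuum / crossing theorems of this node pair on the A0 slab are IMPORTED from `CanonicalFloorA0SlabW32TwoW5MixedContinuum` (g6 p527968, same pair) — this file types only the two new uniform words at g = 3/10 and 1/3.)
# A0 (t′ = −1/4) pinning-field response floor on the DENSITY SLAB `n ∈ [173 / 200, 177 / 200]` — TWO-W5 EDITION `A0SlabW32xK3K4` against the n-TANGENT floor of CERTIFIED `#504` (`#517`)

EDITION NOTE (seat hubbard-cq-obsth-2 g22, 2026-08-29; PRE-REGISTERED cq STATUS 02:08:35Z, object (C)): **CROSS-PAIR `32 × 4` TWO-W5 EDITION** — LOW = the κ 3/7, μ₀ 7/4 state `…k3o7_j264564…` (sourced energy CERTIFIED #562; every typed conjunct — N, E_μ0, docc, K₂ — REPLAYED exactly by floor W5-EXACT-REPLAY R1 kit j320534 + crit-2 countersign, cq RULING 405), HIGH = the κ 4/7, μ₀ 9/4 state `…k4o7_j271580…` (floor W5-EXACT-REPLAY R3 kit j321859; cq RULING 406 (0) booking rule). Same node pair as `CanonicalFloorW32TwoW5XK3K4Continuum.lean`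 (t′0 head 0.2319306), `CanonicalFloorA0W32TwoW5XK3K4Continuum.lean` (A0 head 0.2645899) and the g6 «W32TwoW5Mixed» A0-slab / desk-3-D files. The construction text below is the lane generator's (object provenance of the earlier 64×4-fed / same-family editions kept for the mechanism); any class phrase in it («CANDIDATE: W5 certification word pending», «seat … g8/g9/g10/g18») is SUPERSEDED by this note — the booking class is the lead's (CANDIDATE until R3 PASS + countersign; then «OF RECORD (W5 nodes REPLAYED)»).

Cell hubbard-cq (rung CQ, CQ-TABLE TWELFTH-ENTRY class «(8, n, −¼), n ∈ [0.865, 0.885]»; seat hubbard-cq-obsth-2 g6; RULING 234 (3): «floor side = CERTIFIED #504 AND its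
n-tangent #517 where a density direction enters»). The canonical four-corner mixture of two cluster caps bracketing a density can TARGET ANY density `n` between them;
with the two `t′ = 0` W5 `32 × 4` states transported to `t′ = −1/4` by their diag-hop rows (LOW `cert_sgf_openbox32x4_U8_mu7o4_k3o7_j264564_twoFieldDiagHop`, density ≈ 0.8536143;
HIGH `cert_sgf_openbox32x4_U8_mu9o4_k4o7_j271580_twoFieldDiagHop`, density ≈ 0.8997241) the whole slab `[173 / 200, 177 / 200]` is inside the bracket, and the zero-field floor at density `n` is the
m-SYMBOLIC n-TANGENT LOWER of CERTIFIED `#504`: `DerivedNTangentR504Sym.derived_r504_ntangent_sq_U8_msym_tpm1o4` (module `Certificates.HubbardSquare_msym_lower_derived_ntangent504_row517`, CERTIFIED `#517`,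
exactly as strong as `#504`): `ℓ₅₀₄ + μ₅₀₄·(n − 7/8) ≤ e(1, −1/4, 8, n)`, `ℓ₅₀₄ = -1008420703687177600106633/1208925819614629174706176`, `μ₅₀₄ = 819507284335/549755813888`. The corner caps are affine in `n` and in `g` separately (bilinear);
per branch ONE theorem on the rectangle slab × branch with an exact bilinear majorant, then UNIFORM-in-`n` decimals at the grid fields (numerator affine in `n` at fixed `g` ⇒ worse slab end)
and the crossing field `h×(n)` at `n ∈ {173/200, 7/8, 177/200}`.
UNIFORM WORDS (∀ n ∈ [173 / 200, 177 / 200], 7 dp down): 0.2048559 @ g = 3/10 (h_tree 0.42426) · 0.2399809 @ g = 1/3 (h_tree 0.47140).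
Crossing h×(n): n = 173/200: (0.2611090, 0.2611091); n = 7/8: (0.2645899, 0.2645900); n = 177/200: (0.2679754, 0.2679755).
At `n = 7/8` the numerators reduce to the A0 two-W5 numerators of `CanonicalFloorA0W32TwoW5K3o7Continuum.lean` / `…K4o7…` up to the `#504 ↔ #517` identity at `m = 7/8`
(`derived_r504_ntangent_msym_anchor`) and the pad. Today's TWELFTH-ENTRY n-tangent edition (x2dk `4 × 3` objects, p507808 → p523149): 0.0583154 @ 0.40406 · 0.2264206 @ 0.60609 ·
0.3293008 @ 0.80812 on the same slab.

HONEST FRAMING: forced finite-field RESPONSE floors at large pairing fields on infinite-volume ground states, for EVERY fixed density of the slab, at `t′ = −1/4`;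
CONDITIONAL on CERTIFIED `#517` (a DERIVED symbolic row exactly as strong as `#504`, retracted with it) and the two diag-hop W5 claim nodes (CANDIDATE: 32 × 4 certification
word pending; K₂ rows = ird-4 reader-2 intervals of record); never order, no `h → 0` content, no doping-trend sentence, no phase word, not a superconductivity verdict.
Zero compute (exact ℚ generator `tools/gen_a0_twoW5_slab.py`, this seat); no definition; no named fact; no `sorry`.
References: Griffiths, Phys. Rev. 152 (1966) 240 §II; D. Ruelle, *Statistical Mechanics* (1969) §3.3–3.4.
-/

noncomputable section

namespace Summit.Ventures.CertifiedManyBodySolver.Observables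

open Matrix Finset Literature.Probability.LatticeModels
open Literature.MathematicalPhysics.QuantumLattice Literature.MathematicalPhysics.QuantumLattice.ThermodynamicLimit
open Literature.MathematicalPhysics.QuantumLattice.TwoCluster
open Summit.Ventures.CertifiedManyBodySolver.Certificates
open scoped ComplexOrder



section Branch_b2_A0SlabW32xK3K4

variable {ω : InfVolFermionState 2}

/-- **UNIFORM ON THE SLAB at `g = 3/10`** (`h_tree ≈ 0.42426`): for EVERY density `n ∈ [173 / 200, 177 / 200]` and every translation-invariant
density-`n` minimiser of `E^{−1/4}_{√2·3/10}(1, 8)`: `0.2048559 ≤ Re ω(P₀^d)` (numerator affine in `n`: margins `+0.176494309` at `n = 173 / 200`,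
`+0.173826019` at `n = 177 / 200`; 7 dp down at the worse end). CONDITIONAL; a finite-field RESPONSE floor on a density slab, not an order parameter,
no doping-trend sentence, no phase word. [cite: Griffiths1966, §II] -/
theorem canonicalFloorA0slab_A0SlabW32xK3K4_uniform_g3o10 (n : ℝ) (hn : (173 / 200 : ℝ) ≤ n ∧ n ≤ 177 / 200)
    (hω : ω.IsTranslationInvariant) (hρ : ω.density = n)
    (hmin : ∀ ω' : InfVolFermionState 2, ω'.IsTranslationInvariant → ω'.density = n →
      ω.meanEnergy (hubbardTTPrimeSourcedInteraction 1 (-1 / 4) 8 0 dWaveFormFactor (Real.sqrt 2 * (3 / 10 : ℝ))) 1 ≤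
        ω'.meanEnergy (hubbardTTPrimeSourcedInteraction 1 (-1 / 4) 8 0 dWaveFormFactor (Real.sqrt 2 * (3 / 10 : ℝ))) 1)
    (h517 : DerivedNTangentR504Sym.derived_r504_ntangent_sq_U8_msym_tpm1o4)
    (hW₁ : cert_sgf_openbox32x4_U8_mu7o4_k3o7_j264564_twoFieldDiagHop) (hW₂ : cert_sgf_openbox32x4_U8_mu9o4_k4o7_j271580_twoFieldDiagHop) :
    (0.2048559 : ℝ) ≤
      (ω.expect (pairRegion (insert 0 unitSteps) 0) (localPairAt (insert 0 unitSteps) dWaveFormFactor 0)).re :=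
  (le_chord_of_decimal_bound (by norm_num) (by norm_num) (by push_cast; nlinarith [hn.1, hn.2])).trans
    (canonicalFloorA0slab_A0slabW5mixed_b2_continuum n (3 / 10 : ℝ) hn (by norm_num) ⟨by norm_num, by norm_num⟩ hω hρ hmin h517 hW₁ hW₂)

/-- **UNIFORM ON THE SLAB at `g = 1/3`** (`h_tree ≈ 0.47140`): for EVERY density `n ∈ [173 / 200, 177 / 200]` and every translation-invariant
density-`n` minimiser of `E^{−1/4}_{√2·1/3}(1, 8)`: `0.2399809 ≤ Re ω(P₀^d)` (numerator affine in `n`: margins `+0.227488889` at `n = 173 / 200`,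
`+0.226256182` at `n = 177 / 200`; 7 dp down at the worse end). CONDITIONAL; a finite-field RESPONSE floor on a density slab, not an order parameter,
no doping-trend sentence, no phase word. [cite: Griffiths1966, §II] -/
theorem canonicalFloorA0slab_A0SlabW32xK3K4_uniform_g1o3 (n : ℝ) (hn : (173 / 200 : ℝ) ≤ n ∧ n ≤ 177 / 200)
    (hω : ω.IsTranslationInvariant) (hρ : ω.density = n)
    (hmin : ∀ ω' : InfVolFermionState 2, ω'.IsTranslationInvariant → ω'.density = n →
      ω.meanEnergy (hubbardTTPrimeSourcedInteraction 1 (-1 / 4) 8 0 dWaveFormFactor (Real.sqrt 2 * (1 / 3 : ℝ))) 1 ≤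
        ω'.meanEnergy (hubbardTTPrimeSourcedInteraction 1 (-1 / 4) 8 0 dWaveFormFactor (Real.sqrt 2 * (1 / 3 : ℝ))) 1)
    (h517 : DerivedNTangentR504Sym.derived_r504_ntangent_sq_U8_msym_tpm1o4)
    (hW₁ : cert_sgf_openbox32x4_U8_mu7o4_k3o7_j264564_twoFieldDiagHop) (hW₂ : cert_sgf_openbox32x4_U8_mu9o4_k4o7_j271580_twoFieldDiagHop) :
    (0.2399809 : ℝ) ≤
      (ω.expect (pairRegion (insert 0 unitSteps) 0) (localPairAt (insert 0 unitSteps) dWaveFormFactor 0)).re :=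
  (le_chord_of_decimal_bound (by norm_num) (by norm_num) (by push_cast; nlinarith [hn.1, hn.2])).trans
    (canonicalFloorA0slab_A0slabW5mixed_b2_continuum n (1 / 3 : ℝ) hn (by norm_num) ⟨by norm_num, by norm_num⟩ hω hρ hmin h517 hW₁ hW₂)

end Branch_b2_A0SlabW32xK3K4

end Summit.Ventures.CertifiedManyBodySolver.Observables

end
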